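import Summits.Ventures.PackingBounds.Energy.FivePointCkTwo
import Summits.Ventures.PackingBounds.Configurations.FivePointConfigs
import HarnessLib

/-!
# Five points on `S²`, potential `(1+⟪x,y⟫)²`: the two-sided statement

Framing: lottery ticket; floor = certified bounds/negative ranges. Venture `PackingBounds`, cell
`pub-packcert`, energy family E3PT (pub-packcert-energy gen 12).

Combines the kernel-checked sharp three-point bound `FivePointCkTwo.ck2_five_points`
(`Σ_{x ≠ y} (1+⟪x,y⟫)² ≥ 27/2` for every five unit vectors of `ℝ³`) with the explicit triangular bipyramid
`Config.Bipyramid.pts` (inner products `-1, -1/2, 0`): the minimum is exactly `27/2` (ordered pairs),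
attained by the triangular bipyramid.
-/

noncomputable section

open Finset
open scoped RealInnerProductSpace

namespace Summit.Ventures.PackingBounds.Energy.FivePointCkTwo

open Summit.Ventures.PackingBounds.Config

/-- The triangular bipyramid has `(1+t)²`-energy `27/2` (ordered pairs: `2·(0 + 3·1) + 3·(2·1 + 2·(1/4))`). -/
theorem bipyramid_ck2_energy :
    ∑ x ∈ Bipyramid.pts, ∑ y ∈ Bipyramid.pts.erase x, (1 + inner ℝ x y) ^ 2 = 27 / 2 := by
  have e := Bipyramid.energy_pts (fun t : ℝ => (1 + t) ^ 2)
  rw [e]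
  norm_num

/-- **Five points on `S²`, potential `(1+⟪x,y⟫)²`, two-sided:** the least value of `Σ_{x ≠ y} (1+⟪x,y⟫)²`
over five unit vectors of `ℝ³` is `27/2`, attained by the triangular bipyramid. -/
theorem ck2_five_points_isLeast :
    IsLeast {E : ℝ | ∃ C : Finset (EuclideanSpace ℝ (Fin 3)), C.card = 5 ∧ (∀ x ∈ C, ‖x‖ = 1) ∧
      E = ∑ x ∈ C, ∑ y ∈ C.erase x, (1 + inner ℝ x y) ^ 2} (27 / 2) := by
  refine ⟨⟨Bipyramid.pts, Bipyramid.card_pts, Bipyramid.norm_pts, bipyramid_ck2_energy.symm⟩, ?_⟩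
  rintro E ⟨C, h5, hC, rfl⟩
  simpa using ck2_five_points C hC h5

end Summit.Ventures.PackingBounds.Energy.FivePointCkTwo
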